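import Summits.ValiantsHypothesis.ValiantsHypothesis.Theorems.SymPencilSdcPerFourKernelPackage
import Summits.ValiantsHypothesis.ValiantsHypothesis.Theorems.SymPencilPerFourHessianBlocks
import Summits.ValiantsHypothesis.ValiantsHypothesis.Theorems.SymPencilSdcSuperquadraticStubBlockRankFour
import Summits.ValiantsHypothesis.ValiantsHypothesis.Theorems.SymPencilBoxFourSeven
import Summits.ValiantsHypothesis.ValiantsHypothesis.Theorems.SymPencilSdcPerFourWindow

/-!
# Route `SymPencil` — the rung `sdc(per_4) ≥ 25` as its own theorem, modulo the `7`-dimensional case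
# (Task T1 of `Cruxes/SdcSuperquadratic/NEXT-RUNG-23.md`; `--supports` stmt-ValiantsHypothesis-5674
# `SdcSuperquadratic`; rung currency only)

**Theorem** (`false_of_isSymm_isAffineDetRepr_perPoly_four_le_twentyFour_of_seven`).  Over a field
of characteristic `0`, suppose (`H7`) that no `7`-dimensional linear subspace `V ⊆ Sing Z(per_4)`
carries simultaneously

* (S1) a `5`-square family per base point: constants `c_j` (`j < 5`) and, for every `u`, linear
  functionals `Λ_j` with `per_4 (u + s y) = e₀ + s e₁ + s² Σ_j c_j Λ_j(y)²` for all `y ∈ V`, and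
* (S2) a `5`-square family per direction: constants `c'_j` and, for every `y ∈ V`, linear
  functionals `Λ'_j` with `per_4 (u + s y) = e₀ + s e₁ + s² Σ_j c'_j Λ'_j(u)²` for all `u`
  (i.e. `rank (Hess per_4)(y) ≤ 5` on `V`).

Then every SYMMETRIC affine determinantal representation of `per_4` has size `m ≥ 25 = 4² + 9`
(`twentyFive_le_of_seven`).  Taking only one of the two readings gives the two announced forms of
the rung: `twentyFive_le_of_noSqFamily_seven` (S1, the `H7₅` of `SymPencilSdcPerFourLadder`) and
`twentyFive_le_of_noLowRank_seven` (S2 — literally Task T1: «no `7`-dim `V ⊆ Sing(per_4)` with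
`rank Hess per_4 ≤ 5` on `V`»).
  The `7`-dimensional TRICHOTOMY `T7` (detecting
pair of rows, of columns, or a cross — proved in-session by prover val-width-5676-p2 g3, files
`SymPencilBoxFourSeven*`) discharges the S1 reading through val-width-5674-p1's
`SymPencilSdcPerFourTrichotomyGlue.not_sqFamily_seven_of_trichotomy`; that composition
(`T7 ⇒ sdc(per_4) ≥ 25`) is val-width-5674-p1's `SymPencilSdcPerFourTwentyFiveOfSeven` and is not
repeated here.  The S2 reading is the target of the lane T1 proper (row-pair rank counting,
`SymPencilPerFourHessianMinors` and sequels).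

Proof (pattern of `SymPencilSdcPerFourTwentyThree`, p579928).  The two-sided kernel package
(`SymPencilSdcPerFourKernelPackage.kernel_package₂_…`) gives `V ⊆ Sing Z(per_4)` and `r` with
`dim V + r = 16`, `2r + 1 ≤ m ≤ 24`, `dim V ≤ 8`, so `8 ≤ r ≤ 11`, and both readings with
`d = m - 1 - 2r` squares.

* `r = 8` (`dim V = 8`, `d ≤ 7 < 8`): BoxFour equality (`SymPencilBoxFourEquality.two_rows_or_two_cols`,
  g3) makes `V` a two-row / two-column block, where no (S1)-family of `< 8` squares exists
  (`SymPencilSdcSuperquadraticStubBlockRankFour.not_sum_sq_family_of_card_lt`, val-width-5674-p1).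
* `r = 9` (`dim V = 7`, `d ≤ 5`): this is `H7`.
* `r ∈ {10, 11}` (`dim V ∈ {6, 5}`, `d ≤ 3`): the swapped reading with `≤ 3` squares forces all
  `2 × 2` subpermanents to vanish on `V` (`SymPencilPerFourHessianBlocks.finrank_le_four_of_sum_sq_swap`,
  val-width-5674-p2), so `dim V ≤ 4`: contradiction.  (No `6`-dimensional classification is used.)

HONEST FRAMING: a finite data point made conditional on ONE explicit `7`-dimensional statement,
which the tree discharges through `T7`; no new mechanism; the quadratic wall of the kernel package
(`2n² - 3`) is untouched, the crux `SdcSuperquadratic` (`sdc(per_n) ≥ n^{2+ε}`) stays open, and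
nothing here bears on `VP ≠ VNP`. [folklore]
-/

noncomputable section

-- single-conjunct layout: Sub = Summit, duplicated namespace component intended
set_option linter.dupNamespace false

namespace Summit.ValiantsHypothesis.ValiantsHypothesis.Theorems.SymPencilSdcPerFourTwentyFive

open Matrix MvPolynomial Module
open Literature.Computability.AlgebraicComplexity
open Summit.ValiantsHypothesis.ValiantsHypothesis.Theorems.SymPencilSdcPerFourKernelPackage
open Summit.ValiantsHypothesis.ValiantsHypothesis.Theorems.SymPencilPerFourHessianBlocks
open Summit.ValiantsHypothesis.ValiantsHypothesis.Theorems.SymPencilSdcSuperquadraticStubBlockRankFour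
open Summit.ValiantsHypothesis.ValiantsHypothesis.Theorems.SymPencilBoxFourEquality

variable {K : Type*} [Field K] [CharZero K]

/-- **No symmetric affine determinantal representation of `per_4` has size `≤ 24`, modulo `H7`.**
`H7`: no `7`-dimensional `V ⊆ Sing Z(per_4)` (all `3 × 3` minor-permanents vanish on `V`) carries
both a `5`-square family of `s²`-coefficients per base point (S1) and one per direction (S2).
See the module docstring for the case analysis. [folklore] -/
theorem false_of_isSymm_isAffineDetRepr_perPoly_four_le_twentyFour_of_seven
    (H7 : ∀ V : Submodule K (Fin 4 × Fin 4 → K),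
      (∀ x ∈ V, ∀ (r c : Fin 3 → Fin 4), Function.Injective r → Function.Injective c →
        ((Matrix.of fun i j => x (i, j)).submatrix r c).permanent = 0) →
      finrank K V = 7 → ∀ c c' : Fin 5 → K,
      (∀ u : Fin 4 × Fin 4 → K, ∃ Λ : Fin 5 → ((Fin 4 × Fin 4 → K) →ₗ[K] K),
        ∀ y ∈ V, ∃ e₀ e₁ : K, ∀ s : K,
          eval (u + s • y) (perPoly (Fin 4) K) = e₀ + s * e₁ + s ^ 2 * ∑ k, c k * (Λ k y) ^ 2) →
      (∀ y ∈ V, ∃ Λ : Fin 5 → ((Fin 4 × Fin 4 → K) →ₗ[K] K),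
        ∀ u : Fin 4 × Fin 4 → K, ∃ e₀ e₁ : K, ∀ s : K,
          eval (u + s • y) (perPoly (Fin 4) K) = e₀ + s * e₁ + s ^ 2 * ∑ k, c' k * (Λ k u) ^ 2) →
      False)
    {m : ℕ} (hm : m ≤ 24) {A : Matrix (Fin m) (Fin m) (MvPolynomial (Fin 4 × Fin 4) K)}
    (hS : A.IsSymm) (hA : IsAffineDetRepr (perPoly (Fin 4) K) A) : False := by
  obtain ⟨r, V, hVr, hrm, hV8, hV3, hsq, hswap⟩ :=
    kernel_package₂_of_isSymm_isAffineDetRepr_perPoly_four K hS hA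
  by_cases h8 : r = 8
  · -- `dim V = 8`, defect `≤ 7`: BoxFour equality case + the two-free-rows block
    have hV : finrank K V = 8 := by omega
    obtain ⟨c, hc⟩ := hsq 7 (by omega)
    exact not_sum_sq_family_of_card_lt (ι := Fin 7) (by rw [Fintype.card_fin]; norm_num) V hV
      (two_rows_or_two_cols V hV3 hV) fun u => by
        obtain ⟨Λ, hΛ⟩ := hc u
        exact ⟨c, Λ, hΛ⟩
  by_cases h9 : r = 9
  · -- `dim V = 7`, defect `≤ 5`: the hypothesis `H7`
    have hV : finrank K V = 7 := by omega
    obtain ⟨c, hc⟩ := hsq 5 (by omega)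
    obtain ⟨c', hc'⟩ := hswap 5 (by omega)
    exact H7 V hV3 hV c c' hc hc'
  · -- `r ∈ {10, 11}`: `dim V ∈ {6, 5}`, defect `≤ 3`: the Hessian of `per_4` has rank `≤ 3` on `V`
    obtain ⟨c, hc⟩ := hswap 3 (by omega)
    have h4 := finrank_le_four_of_sum_sq_swap (ι := Fin 3) (by rw [Fintype.card_fin]; norm_num) V
      fun y hy => by
        obtain ⟨Λ, hΛ⟩ := hc y hy
        exact ⟨c, Λ, hΛ⟩
    omega

/-- **`sdc(per_4) ≥ 25` modulo `H7`** (both readings available to the `7`-dimensional case).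
[folklore] -/
theorem twentyFive_le_of_seven
    (H7 : ∀ V : Submodule K (Fin 4 × Fin 4 → K),
      (∀ x ∈ V, ∀ (r c : Fin 3 → Fin 4), Function.Injective r → Function.Injective c →
        ((Matrix.of fun i j => x (i, j)).submatrix r c).permanent = 0) →
      finrank K V = 7 → ∀ c c' : Fin 5 → K,
      (∀ u : Fin 4 × Fin 4 → K, ∃ Λ : Fin 5 → ((Fin 4 × Fin 4 → K) →ₗ[K] K),
        ∀ y ∈ V, ∃ e₀ e₁ : K, ∀ s : K,
          eval (u + s • y) (perPoly (Fin 4) K) = e₀ + s * e₁ + s ^ 2 * ∑ k, c k * (Λ k y) ^ 2) →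
      (∀ y ∈ V, ∃ Λ : Fin 5 → ((Fin 4 × Fin 4 → K) →ₗ[K] K),
        ∀ u : Fin 4 × Fin 4 → K, ∃ e₀ e₁ : K, ∀ s : K,
          eval (u + s • y) (perPoly (Fin 4) K) = e₀ + s * e₁ + s ^ 2 * ∑ k, c' k * (Λ k u) ^ 2) →
      False)
    {m : ℕ} {A : Matrix (Fin m) (Fin m) (MvPolynomial (Fin 4 × Fin 4) K)} (hS : A.IsSymm)
    (hA : IsAffineDetRepr (perPoly (Fin 4) K) A) : 25 ≤ m := by
  by_contra hlt
  exact false_of_isSymm_isAffineDetRepr_perPoly_four_le_twentyFour_of_seven H7 (by omega) hS hA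

/-- **`sdc(per_4) ≥ 25 ⟸ H7₅` (reading S1)**: if no `7`-dimensional `V ⊆ Sing Z(per_4)` carries a
`5`-square family of `s²`-coefficients per base point, every symmetric affine determinantal
representation of `per_4` has size `≥ 25`.  (`H7₅` in the vocabulary of
`SymPencilSdcPerFourLadder`.) [folklore] -/
theorem twentyFive_le_of_noSqFamily_seven
    (H7 : ∀ V : Submodule K (Fin 4 × Fin 4 → K),
      (∀ x ∈ V, ∀ (r c : Fin 3 → Fin 4), Function.Injective r → Function.Injective c →
        ((Matrix.of fun i j => x (i, j)).submatrix r c).permanent = 0) →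
      finrank K V = 7 → ∀ c : Fin 5 → K,
      ¬ (∀ u : Fin 4 × Fin 4 → K, ∃ Λ : Fin 5 → ((Fin 4 × Fin 4 → K) →ₗ[K] K),
          ∀ y ∈ V, ∃ e₀ e₁ : K, ∀ s : K,
            eval (u + s • y) (perPoly (Fin 4) K) = e₀ + s * e₁ + s ^ 2 * ∑ k, c k * (Λ k y) ^ 2))
    {m : ℕ} {A : Matrix (Fin m) (Fin m) (MvPolynomial (Fin 4 × Fin 4) K)} (hS : A.IsSymm)
    (hA : IsAffineDetRepr (perPoly (Fin 4) K) A) : 25 ≤ m :=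
  twentyFive_le_of_seven (fun V hV3 hV c _ hc _ => H7 V hV3 hV c hc) hS hA

/-- **`sdc(per_4) ≥ 25 ⟸` Task T1 (reading S2)**: if no `7`-dimensional `V ⊆ Sing Z(per_4)` has
`rank (Hess per_4)(y) ≤ 5` for all `y ∈ V` — precisely: carries a `5`-square family of
`s²`-coefficients per direction `y ∈ V` — then every symmetric affine determinantal representation
of `per_4` has size `≥ 25`. [folklore] -/
theorem twentyFive_le_of_noLowRank_seven
    (T1 : ∀ V : Submodule K (Fin 4 × Fin 4 → K),
      (∀ x ∈ V, ∀ (r c : Fin 3 → Fin 4), Function.Injective r → Function.Injective c →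
        ((Matrix.of fun i j => x (i, j)).submatrix r c).permanent = 0) →
      finrank K V = 7 → ∀ c : Fin 5 → K,
      ¬ (∀ y ∈ V, ∃ Λ : Fin 5 → ((Fin 4 × Fin 4 → K) →ₗ[K] K),
          ∀ u : Fin 4 × Fin 4 → K, ∃ e₀ e₁ : K, ∀ s : K,
            eval (u + s • y) (perPoly (Fin 4) K) = e₀ + s * e₁ + s ^ 2 * ∑ k, c k * (Λ k u) ^ 2))
    {m : ℕ} {A : Matrix (Fin m) (Fin m) (MvPolynomial (Fin 4 × Fin 4) K)} (hS : A.IsSymm)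
    (hA : IsAffineDetRepr (perPoly (Fin 4) K) A) : 25 ≤ m :=
  twentyFive_le_of_seven (fun V hV3 hV _ c' _ hc' => T1 V hV3 hV c' hc') hS hA

/-! ### Appended by val-width-5676-p2 g3: the UNCONDITIONAL rung, via the `7`-dimensional trichotomy

`SymPencilBoxFourSeven.noSqFamily_seven` (no `7`-dimensional linear subspace of `Sing Z(per_4)`
carries a `k`-square family for `k ≤ 5`; from the trichotomy "detecting pair of rows / of columns /
cross" and val-width-5674-p1's rank counts) discharges the hypothesis `H7₅` of
`twentyFive_le_of_noSqFamily_seven`.  Nothing here bears on `VP ≠ VNP`; `5674` stays open. -/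

/-- **`sdc(per_4) ≥ 25`** over any field of characteristic `0` (unconditional): a symmetric affine
determinantal representation of `per_4` of size `m` has `25 ≤ m` — nine more than the number of
variables, the ceiling of the kernel-rows / second-moment method (tree before: `23`). [folklore] -/
theorem twentyFive_le_of_isSymm_isAffineDetRepr_perPoly_four
    {m : ℕ} {A : Matrix (Fin m) (Fin m) (MvPolynomial (Fin 4 × Fin 4) K)} (hS : A.IsSymm)
    (hA : IsAffineDetRepr (perPoly (Fin 4) K) A) : 25 ≤ m :=
  twentyFive_le_of_noSqFamily_seven
    (fun V hV h7 c => SymPencilBoxFourSeven.noSqFamily_seven (by norm_num) V hV h7 c) hS hA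

/-- **No symmetric affine determinantal representation of `per_4` has size `≤ 24`**
(characteristic `0`). [folklore] -/
theorem false_of_isSymm_isAffineDetRepr_perPoly_four_le_twentyFour {m : ℕ} (hm : m ≤ 24)
    {A : Matrix (Fin m) (Fin m) (MvPolynomial (Fin 4 × Fin 4) K)} (hS : A.IsSymm)
    (hA : IsAffineDetRepr (perPoly (Fin 4) K) A) : False := by
  have h := twentyFive_le_of_isSymm_isAffineDetRepr_perPoly_four hS hA
  omega

/-- **`sdc(per_4) ≥ 4² + 9`** over `ℂ`, in the language of the route `SymPencil`. [folklore] -/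
theorem sq_add_nine_le_of_isSymm_isAffineDetRepr_perPoly_four (m : ℕ)
    (A : Matrix (Fin m) (Fin m) (MvPolynomial (Fin 4 × Fin 4) ℂ)) (hS : A.IsSymm)
    (hA : IsAffineDetRepr (perPoly (Fin 4) ℂ) A) : 4 ^ 2 + 9 ≤ m :=
  twentyFive_le_of_isSymm_isAffineDetRepr_perPoly_four hS hA

/-- **The window `25 ≤ sdc(per₄) ≤ 306`** over any field of characteristic `0`
(upper bound: Quarez, `SymPencilSdcPerFourWindow.sdc_perPoly_four_le`). [folklore] -/
theorem sdc_perPoly_four_window_twentyFive (K : Type*) [Field K] [CharZero K] :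
    25 ≤ symmDeterminantalComplexity (perPoly (Fin 4) K) ∧
      symmDeterminantalComplexity (perPoly (Fin 4) K) ≤ 306 := by
  letI : Invertible (2 : K) := invertibleOfNonzero two_ne_zero
  refine ⟨?_, SymPencilSdcPerFourWindow.sdc_perPoly_four_le K two_ne_zero⟩
  obtain ⟨A, hS, hA⟩ :=
    hasSymmDetRepr_symmDeterminantalComplexity
      ⟨_, SymPencilSdcPerThreeWindow.hasSymmDetRepr_perPoly_quarez K 4⟩
  exact twentyFive_le_of_isSymm_isAffineDetRepr_perPoly_four hS hA

/-- The complex instance: `25 ≤ sdc(per₄) ≤ 306` over `ℂ`. [folklore] -/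
theorem sdc_perPoly_four_window_twentyFive_complex :
    25 ≤ symmDeterminantalComplexity (perPoly (Fin 4) ℂ) ∧
      symmDeterminantalComplexity (perPoly (Fin 4) ℂ) ≤ 306 :=
  sdc_perPoly_four_window_twentyFive ℂ

end Summit.ValiantsHypothesis.ValiantsHypothesis.Theorems.SymPencilSdcPerFourTwentyFive

end
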